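import Summits.CriticalPhenomena.CardyFormulaZ2.Theorems.CardyUniqueLimitCardyRigiditySlitCardyCutEta
import Summits.CriticalPhenomena.CardyFormulaZ2.Theorems.CardyUniqueLimitCardyRigiditySlitCardyCutClock
import HarnessLib

/-!
# Cut-1 of STUB A3b: the slit-Cardy estimate before the level time implies the
# slit-observable estimate (freezing at the level step)

Crux `Summit.CriticalPhenomena.CardyFormulaZ2.Theses.CardyUniqueLimit.CardyRigidity`
(stmt-CriticalPhenomena-0746), line `crossing_martingale`, stub A3b `stub_slitObservableApprox`
(`PercSlitObservableApprox f`, `…SlitCrossingClockAssembly.lean`).  Following Camia–Newman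
(2007, §5, proof of Thm 3: "freezing at the level step"), A3b is CUT at the predicate

* `PercSlitCardy f` — **the direct slit-Cardy estimate BEFORE the level time**: along the KS
  data, for admissible `(x; m, M, d)` and a horizon `t'`, eventually in `k`, FIXED
  (`ω`-independent) site sets `X₁ k`, `X₂ k` (intended: the discrete arcs `(u₂, u₁)` and
  `(u₀, a_k)` of the arc `A`, `uᵢ ≈ Φ_k(-xᵢ)`, thickened by collars of width `→ 0` slower than
  the boundary discrepancies of the data) and a small event off which, for every depth `n`
  whose explored piece has capacity time `T ≤ t'` through `φ_k` STRICTLY BEFORE the level time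
  of `V^k = -drivingFunction φ_k`: (no early contact) the left bank of the prefix has met `A`
  only inside `X₂ k`, and (Cardy) the `P_{1/2}`-probability of the slit crossing event
  `slitCrossing (X₁ k) (X₂ k) ω n` of `…SlitCrossingEventIdentity.lean` — `X₁ k ↔ X₂ k ∪`
  left bank through unrevealed free open edges — is within `ε_k → 0` of `f (η_T)`;

and the cut is PROVED: `slitCardy_percSlitObservableApprox_of :
ContinuousOn f (Ioo 0 1) → PercSlitCardy f → PercSlitObservableApprox f`
(worked form `SlitCardyCut.percSlitObservableApprox_of_slitCardy`).
Proof: given `(x; m, M, d)` and `t'`, use the predicate with the RELAXED levels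
`(m/2, M+1, d/2)` and horizon `t' + 1`; at scale `k` let `θ_n` be the capacity clock capped at
`L = t' + 1` (`CapacityClock.clock`, a sure class function of the prefix), `ρ` the level time
of `V^k ω` and `ν` the first depth with `ρ ≤ θ_n` read on the describable representative of the
prefix class (a bounded class stopping step, by locality of the driving values below the clock
and of the level time in the driver); take `X = percSlitExpectation ν 1_Q`, `Q` the fixed free
crossing event `X₁ k ↔ X₂ k` (`SlitCardyCut.exists_frozenCrossing`: its slit expectation at
depth `n` is `P_{1/2}(slitCrossing … (n ∧ ν))` by Freezing + EventIdentity + no early contact).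
Before the level step (`T < ρ`, `n < ν`) the slit-Cardy estimate at `(n, T)` is the claim; from
the level step on, both sides are frozen: `θ_ν ∈ [ρ, ρ + Δ_k]` (clock increments off the box
event, `SlitCardyCut.eventually_clock_box`, `…SlitCardyCutClock.lean`), the marks move by `o(1)`
on that window (`…SlitCardyCutFlow.lean`: real Loewner equation, box modulus of the driver), so
`θ_ν` is before the relaxed level time, the slit-Cardy estimate applies at `(ν, θ_ν)`, and
`|f(η_{θ_ν}) - f(η_ρ)| = o(1)` by uniform continuity of `f` on the compact range of moduli of
the relaxed level box (`…SlitCardyCutEta.lean`); a diagonal choice of rates concludes.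
-/

noncomputable section

open MeasureTheory Filter Set Topology Metric
open scoped NNReal ENNReal
open UpperHalfPlane (upperHalfPlaneSet)
open Literature.Probability Literature.Probability.RandomPlanarGeometry
  Literature.Probability.LatticeModels Literature.Probability.LatticeModels.DiscreteDobrushin
open Literature.Probability.Percolation (bondDomainCrossingProb bondInterfaceIn BondConfig
  bondPercolation half measurable_bondInterfaceIn)
open scoped Literature.Probability.RandomPlanarGeometry.PathBorel
open Summit.CriticalPhenomena.CardyFormulaZ2.Cruxes.ParafermionToSLESixFamilies.CaratheodoryNetSlitUniformity
  (percSlitExpectation)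

namespace Summit.CriticalPhenomena.CardyFormulaZ2.Cruxes.CardyRigidity.CrossingMartingale

/-! ### The predicate -/

/-- **(P-Cardy) The slit crossing probabilities before the level time** (the direct form of
Camia–Newman's Theorem 3 along the exploration, with Smirnov's theorem replaced by the
all-rectangle hypothesis, together with its "no close encounter" input, their Lemma 7.1).
Along the KS data, under the orientation hypothesis, for admissible marks/levels and every
horizon `t'`, eventually in `k`: FIXED site sets `X₁, X₂` and a measurable `bad` of
probability `≤ η_k → 0` such that for `ω ∉ bad` with describable interface and every depth `n`
whose explored piece `γ[0, n+1]` has capacity time `T ≤ t'` through `φ_k` STRICTLY BEFORE the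
level time of the sign-reversed driving function `V^k ω = -drivingFunction φ_k (γ_ω)` (so that
`X⁰ ∈ (m, M)` and the gaps `∈ (d, x₂ - x₀ + 1)` on `[0, T]`):
(i) the left bank of the prefix of depth `n` meets the discrete arc `A` only inside `X₂`
(no early contact beyond `u₀`; the hypothesis of `eventIdentity_percSlitExpectation_freeCrossing`);
(ii) the `P_{1/2}`-probability of the slit crossing event of the prefix — `X₁ ↔ X₂ ∪ leftBank`
through unrevealed free open edges (`EventIdentity.slitCrossing`) — is within `ε_k → 0` of
`f (η_T)`, `η_T = etaProc … x T (V^k ω)` the cross-ratio of the mark flows.  Intended sets: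
`X₁ =` the sites of `A` near `Φ_k([-x₂, -x₁])`, `X₂ =` those near `Φ_k([-x₀, 0])`, with collar
widths `→ 0` chosen above the boundary discrepancies of the data (left free here: the cut
`slitCardy_percSlitObservableApprox_of` uses only that they do not depend on `ω`).
(Sources: Camia–Newman 2007, §5, Thm 3 and Lemma 7.1; Smirnov 2001, Thm 2.  A sub-goal of the
crux, stated as a predicate of this route — deliberately NOT a cited Literature fact.) -/
def PercSlitCardy (f : ℝ → ℝ) : Prop :=
    ∀ (D : DobrushinDomain) (E : ℝ → DiscreteDobrushin), ZdDiscretisationFamily D E →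
    ∀ φ : ConformalEquiv upperHalfPlaneSet D.carrier, D.IsChordalUniformizing φ →
    ∀ δs : ℕ → ℝ, (∀ k, 0 < δs k) → Tendsto δs atTop (𝓝 0) →
      ∀ hδadm : ∀ k, (E (δs k)).IsZdAdmissible,
      (∀ᶠ k in atTop, ∀ ω, bondInterfaceIn D (E (δs k)) ω =
        CurveClass.mk ⟨medialExplorationCurve (E (δs k)) ω⟩) →
    ∀ (Ds : ℕ → DobrushinDomain) (φs : ∀ k, ConformalEquiv upperHalfPlaneSet (Ds k).carrier),
      (∀ k, (Ds k).IsChordalUniformizing (φs k)) →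
      (∀ R : ℝ, TendstoUniformlyOn (fun k ↦ (φs k).boundaryExtension) φ.boundaryExtension
        atTop ({z : ℂ | 0 ≤ z.im} ∩ closedBall 0 R)) →
      (∀ ε : ℝ, 0 < ε → ∃ r : ℝ, ∀ᶠ k in atTop, ∀ z : ℂ, z ∈ {z : ℂ | 0 ≤ z.im} → r ≤ ‖z‖ →
        dist ((φs k).boundaryExtension z) ((Ds k).pt 1) ≤ ε) →
      Tendsto (fun k ↦ (Ds k).pt 1) atTop (𝓝 (D.pt 1)) →
      (∀ ε : ℝ≥0∞, 0 < ε → ∃ (δγ δW : ℕ → ℝ) (T : ℕ → ℝ≥0), (∀ j, 0 < δγ j) ∧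
        (∀ j, 0 < δW j) ∧
        ∀ k, bondPercolation (zdGraph 2) half ((bondInterfaceIn D (E (δs k))) ⁻¹'
          ((fun p ↦ compactifiedClass (φs k).boundaryExtension ((Ds k).pt 1) p.1) ''
            {p : C(ℝ≥0, ℂ) × C(ℝ≥0, ℝ) | p ∈ generatedPairs ∧
              p.1 ∈ Process.modulusSet ({0} : Set ℂ) δγ ∧
              p.2 ∈ Process.modulusSet ({0} : Set ℝ) δW ∧
              ∀ (j : ℕ) (t : ℝ≥0), T j ≤ t → (j : ℝ) ≤ ‖p.1 t‖})ᶜ) ≤ ε) →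
    ∀ (x : Fin 3 → ℝ) (m M d : ℝ), AdmissibleLevels x m M d →
    ∀ t' : ℝ≥0,
      ∃ ε η : ℕ → ℝ≥0, Tendsto ε atTop (𝓝 0) ∧ Tendsto η atTop (𝓝 0) ∧
        ∀ᶠ k in atTop, ∃ (X₁ X₂ : Set (Site 2)) (bad : Set (BondConfig (Site 2))),
          MeasurableSet bad ∧ bondPercolation (zdGraph 2) half bad ≤ η k ∧
          ∀ ω, ω ∉ bad → ∀ (n : ℕ) (T : ℝ≥0),
            IsLoewnerDescribable (φs k) (bondInterfaceIn D (E (δs k)) ω) →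
            (φs k).boundaryExtension ''
              (Loewner.trace (drivingFunction (φs k) (bondInterfaceIn D (E (δs k)) ω)) ''
                Icc 0 T) =
              range (polyline ((explorationPrefix (E (δs k)) n ω).map (medialPoint (E (δs k)).δ))) →
            T ≤ t' →
            (T : WithTop ℝ≥0) < levelTime (fun (w : C(ℝ≥0, ℝ)) (r : ℝ≥0) ↦ w r) x m M d
              ⟨fun r ↦ -drivingFunction (φs k) (bondInterfaceIn D (E (δs k)) ω) r,
                (continuous_drivingFunction (φs k) (bondInterfaceIn D (E (δs k)) ω)).neg⟩ →
            EventIdentity.leftBank (hδadm k) ω n ∩ (E (δs k)).zdArcA ⊆ X₂ ∧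
            |(bondPercolation (zdGraph 2) half).real
                (EventIdentity.slitCrossing (hδadm k) X₁ X₂ ω n) -
              f (etaProc (fun (w : C(ℝ≥0, ℝ)) (r : ℝ≥0) ↦ w r) x T
                ⟨fun r ↦ -drivingFunction (φs k) (bondInterfaceIn D (E (δs k)) ω) r,
                  (continuous_drivingFunction (φs k) (bondInterfaceIn D (E (δs k)) ω)).neg⟩)| ≤ ε k

/-! ### The cut -/

/-- **Cut-1 of STUB A3b — PROVED**: continuity of the kernel on `(0,1)` and the slit-Cardy
estimate before the level time with no early contact (`PercSlitCardy f`) imply the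
slit-observable estimate `PercSlitObservableApprox f` (freezing at the level step; see the
module docstring for the proof; anchor `slitCardy_percSlitObservableApprox_of`).
[cite: CamiaNewman2007, §5 and Thm 3] -/
theorem SlitCardyCut.percSlitObservableApprox_of_slitCardy {f : ℝ → ℝ}
    (hf : ContinuousOn f (Ioo 0 1)) (hC : PercSlitCardy f) : PercSlitObservableApprox f := by
  intro D E hEf φ hφ δs hδpos hδ0 hδadm hor Ds φs hφs hU1 hU2 hb hbox x m M d hx t'
  set P : Measure (BondConfig (Site 2)) := bondPercolation (zdGraph 2) half with hP
  have hx' : AdmissibleLevels x (m / 2) (M + 1) (d / 2) := hx.relax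
  obtain ⟨εC, ηC, hεC, hηC, hevC⟩ := hC D E hEf φ hφ δs hδpos hδ0 hδadm hor Ds φs hφs hU1 hU2 hb
    hbox x (m / 2) (M + 1) (d / 2) hx' (t' + 1)
  obtain ⟨ĝ, hĝc, -, k₁, k₂, hĝf, hbox'⟩ := MartingaleOfData.exists_clamp_kernel hf hx'
  set Q : ℕ → ℝ≥0 → Prop := fun k r ↦
    ∃ (X : BondConfig (Site 2) → ℝ) (bad : Set (BondConfig (Site 2))),
      StronglyMeasurable X ∧ (∀ ω, |X ω| ≤ 1) ∧
      MeasurableSet bad ∧ bondPercolation (zdGraph 2) half bad ≤ r ∧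
      ∀ ω, ω ∉ bad → ∀ (n : ℕ) (T : ℝ≥0),
        IsLoewnerDescribable (φs k) (bondInterfaceIn D (E (δs k)) ω) →
        (φs k).boundaryExtension ''
          (Loewner.trace (drivingFunction (φs k) (bondInterfaceIn D (E (δs k)) ω)) '' Icc 0 T) =
          range (polyline ((explorationPrefix (E (δs k)) n ω).map (medialPoint (E (δs k)).δ))) →
        T ≤ t' → |percSlitExpectation (hδadm k) half n X ω -
          crossingObs f (fun (w : C(ℝ≥0, ℝ)) (r : ℝ≥0) ↦ w r) x m M d T
            ⟨fun r ↦ -drivingFunction (φs k) (bondInterfaceIn D (E (δs k)) ω) r,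
              (continuous_drivingFunction (φs k) (bondInterfaceIn D (E (δs k)) ω)).neg⟩| ≤ r
    with hQ
  suffices main : ∀ j : ℕ, ∀ᶠ k in atTop, Q k (1 / ((j : ℝ≥0) + 1)) by
    obtain ⟨r, hr, hev⟩ := CapacityClock.exists_rate_of_forall_eventually main
    exact ⟨r, r, hr, hr, hev⟩
  intro j
  set r : ℝ≥0 := 1 / ((j : ℝ≥0) + 1) with hr
  have hrpos : 0 < r := by positivity
  -- the modulus of `ĝ ∘ η` on the relaxed box, the box at level `r/2`, the window parameters
  obtain ⟨μ, hμ, hΨ⟩ := SlitCardyCut.exists_modulus_eta hĝc (m' := m / 2) (M' := M + 1)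
    (d' := d / 2) (G := x 2 - x 0 + 1) (by linarith [hx.m_pos]) (by linarith [hx.d_pos])
    (κ₁ := r / 4) (by positivity)
  obtain ⟨δγ, δW, Tt, hδγ, hδW, hboxk⟩ := hbox ((r / 2 : ℝ≥0) : ℝ≥0∞)
    (ENNReal.coe_pos.2 (by positivity))
  obtain ⟨μ₀, κ, j', Δ, hΔpos, hμ₀m, hμ₀d, hμ₀1, hμ₀μ, hκ, hκμ, hΔW, hΔhalf, hj't⟩ :=
    SlitCardyCut.exists_window hμ hx.m_pos hx.d_pos t' hδW
  -- eventually in `k`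
  have hclock := SlitCardyCut.eventually_clock_box hEf hφ hδpos hδ0 hδadm hor hφs hU1 hb hδγ hδW Tt
    (t' + 1) hΔpos
  have hεsmall : ∀ᶠ k in atTop, (εC k : ℝ) ≤ r / 2 :=
    (NNReal.tendsto_coe.2 hεC).eventually (Iic_mem_nhds (by positivity))
  have hηCsmall : ∀ᶠ k in atTop, ηC k ≤ r / 2 := hηC.eventually (Iic_mem_nhds (by positivity))
  filter_upwards [hclock, hevC, hεsmall, hηCsmall] with k hclk hCk hεk hηCk
  obtain ⟨X₁, X₂, badC, hbadC, hPbadC, hCk'⟩ := hCk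
  set L : ℝ≥0 := t' + 1 with hL
  set N : ℕ := (finite_innerCorners (hδadm k)).toFinset.card with hN
  set V : BondConfig (Site 2) → C(ℝ≥0, ℝ) := fun ω ↦
    ⟨fun r ↦ -drivingFunction (φs k) (bondInterfaceIn D (E (δs k)) ω) r,
      (continuous_drivingFunction (φs k) (bondInterfaceIn D (E (δs k)) ω)).neg⟩ with hV
  set S : ℕ → BondConfig (Site 2) → Prop := fun n ω ↦
    levelTime (fun (w : C(ℝ≥0, ℝ)) (r : ℝ≥0) ↦ w r) x m M d
        (V (CapacityClock.rep D (E (δs k)) (φs k) n ω)) ≤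
      (CapacityClock.clock D (E (δs k)) (φs k) L n ω : WithTop ℝ≥0) with hS
  obtain ⟨ν, hνN, hνspec, hνmin, hνiff⟩ := SlitCardyCut.exists_levelStep S N
  have hνclass : ∀ (m₁ : ℕ) (ω₀ ω : BondConfig (Site 2)),
      ω ∈ explorationCylinder (hδadm k) ω₀ m₁ → (ν ω ≤ m₁ ↔ ν ω₀ ≤ m₁) := by
    intro m₁ ω₀ ω hω
    refine SlitCardyCut.levelStep_class hνiff fun n hn ↦ ?_
    have hpre := explorationPrefix_eq_of_mem_explorationCylinder
      (explorationCylinder_antitone ω₀ hn hω)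
    simp only [hS]
    rw [CapacityClock.rep_eq_of_prefix_eq hpre, CapacityClock.clock_eq_of_prefix_eq L hpre]
  obtain ⟨X, hXm, hX1, hXid⟩ := SlitCardyCut.exists_frozenCrossing (hδadm k) X₁ X₂ hνclass hνN
  set img : Set (CurveClass ℂ) := (fun p ↦ compactifiedClass (φs k).boundaryExtension ((Ds k).pt 1) p.1) ''
    {p : C(ℝ≥0, ℂ) × C(ℝ≥0, ℝ) | p ∈ generatedPairs ∧
      p.1 ∈ Process.modulusSet ({0} : Set ℂ) δγ ∧ p.2 ∈ Process.modulusSet ({0} : Set ℝ) δW ∧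
      ∀ (j : ℕ) (t : ℝ≥0), Tt j ≤ t → (j : ℝ) ≤ ‖p.1 t‖} with himg
  set bad₀ : Set (BondConfig (Site 2)) := (bondInterfaceIn D (E (δs k))) ⁻¹' imgᶜ with hbad₀
  refine ⟨X, bad₀ ∪ badC, hXm, hX1, ?_, ?_, ?_⟩
  · obtain ⟨hcl, -, -⟩ := isClosed_image_pairBox_and_continuousOn_drivingPath (hφs k) hδγ hδW Tt
    exact (measurable_bondInterfaceIn D (E (δs k)) hcl.measurableSet).compl.union hbadC
  · have hsum : (r / 2 : ℝ≥0) + r / 2 = r := by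
      apply NNReal.eq; push_cast; ring
    calc P (bad₀ ∪ badC) ≤ P bad₀ + P badC := measure_union_le _ _
      _ ≤ ((r / 2 : ℝ≥0) : ℝ≥0∞) + (ηC k : ℝ≥0∞) := add_le_add (hboxk k) hPbadC
      _ ≤ ((r / 2 : ℝ≥0) : ℝ≥0∞) + ((r / 2 : ℝ≥0) : ℝ≥0∞) := by gcongr
      _ = (r : ℝ≥0∞) := by rw [← ENNReal.coe_add, hsum]
  intro ω hω n T hdesc hTn hTt'
  have hωC : ω ∉ badC := fun h ↦ hω (Or.inr h)
  have hωK : bondInterfaceIn D (E (δs k)) ω ∈ img := by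
    by_contra h
    exact hω (Or.inl h)
  obtain ⟨hork', -, ⟨W₀, hW₀, hdrv⟩, hθ0, hincr⟩ := hclk ω hωK
  have hE₀ := hδadm k
  -- the driver at scale `k`: starts at `0`, box modulus
  have hVapp : ∀ u, V ω u = -W₀ u := fun u ↦ by
    simp only [hV, ContinuousMap.coe_mk, hdrv]
  have hV0 : V ω 0 = 0 := by
    rw [hVapp]
    have : W₀ 0 ∈ ({0} : Set ℝ) := hW₀.1
    rw [mem_singleton_iff] at this
    rw [this, neg_zero]
  have hVc : Continuous (V ω) := (V ω).continuous
  -- the clock at depth `n` is `T`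
  have hTL : T < L := lt_of_le_of_lt hTt' (by rw [hL]; exact lt_add_one t')
  have hθn : CapacityClock.clock D (E (δs k)) (φs k) L n ω = T := by
    rw [CapacityClock.clock_eq_min hork' hE₀ (hφs k) L hdesc hTn, min_eq_left hTL.le]
  have hnN : n < N := SlitCardyCut.lt_card_of_hasCap hork' hE₀ (hφs k) hdesc hTn
  have hSiff : ∀ i, S i ω ↔ levelTime (fun (w : C(ℝ≥0, ℝ)) (r : ℝ≥0) ↦ w r) x m M d (V ω) ≤
      (CapacityClock.clock D (E (δs k)) (φs k) L i ω : WithTop ℝ≥0) := by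
    intro i
    have heq : ∀ u, u ≤ CapacityClock.clock D (E (δs k)) (φs k) L i ω →
        V ω u = V (CapacityClock.rep D (E (δs k)) (φs k) i ω) u := fun u hu ↦ by
      simp only [hV, ContinuousMap.coe_mk]
      rw [CapacityClock.drivingFunction_eq_rep hork' hE₀ (hφs k) L hdesc hu]
    exact (SlitCardyCut.levelTime_le_iff_of_eqOn heq x m M d).symm
  rcases lt_or_ge (T : WithTop ℝ≥0)
    (levelTime (fun (w : C(ℝ≥0, ℝ)) (r : ℝ≥0) ↦ w r) x m M d (V ω)) with hlt | hge
  · -- Case A: strictly before the level time; nothing is frozen yet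
    have hnν : n ≤ ν ω := by
      by_contra h
      push Not at h
      rcases hνspec ω with hS' | hN'
      · have h1 := (hSiff _).1 hS'
        have h2 : (CapacityClock.clock D (E (δs k)) (φs k) L (ν ω) ω : WithTop ℝ≥0) ≤ T := by
          rw [← hθn]
          exact WithTop.coe_le_coe.2 (SlitCardyCut.clock_mono hork' hE₀ (hφs k) L h.le hdesc)
        exact absurd ((h1.trans h2).trans_lt hlt) (lt_irrefl _)
      · exact absurd (hN'.trans_lt (h.trans hnN)) (lt_irrefl _)
    have hmin : min n (ν ω) = n := min_eq_left hnν
    have hlt' := SlitCardyCut.coe_lt_levelTime_relax_of_lt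
      (W := fun (w : C(ℝ≥0, ℝ)) (r : ℝ≥0) ↦ w r) (ω := V ω) hVc hx hlt
    obtain ⟨hA, hEst⟩ := hCk' ω hωC n T hdesc hTn (hTt'.trans le_self_add) hlt'
    rw [hXid n ω (by rw [hmin]; exact hA), hmin]
    have hobs : crossingObs f (fun (w : C(ℝ≥0, ℝ)) (r : ℝ≥0) ↦ w r) x m M d T (V ω) =
        f (etaProc (fun (w : C(ℝ≥0, ℝ)) (r : ℝ≥0) ↦ w r) x T (V ω)) := by
      show f (etaProc _ x ((min (T : WithTop ℝ≥0) (levelTime _ x m M d (V ω))).untopA) (V ω)) = _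
      rw [min_eq_left hlt.le]
      rfl
    rw [hobs]
    exact hEst.trans (hεk.trans (by linarith))
  · -- Case B: from the level step on, both sides are frozen
    obtain ⟨ρ₀, hρ₀⟩ : ∃ ρ₀ : ℝ≥0,
        levelTime (fun (w : C(ℝ≥0, ℝ)) (r : ℝ≥0) ↦ w r) x m M d (V ω) = ρ₀ := by
      obtain ⟨a, ha⟩ := WithTop.ne_top_iff_exists.1 (ne_top_of_le_ne_top WithTop.coe_ne_top hge)
      exact ⟨a, ha.symm⟩
    rw [hρ₀] at hge hSiff
    have hρ₀T : ρ₀ ≤ T := WithTop.coe_le_coe.1 hge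
    have hSn : S n ω := (hSiff n).2 (by rw [hθn]; exact hge)
    have hνn : ν ω ≤ n := (hνiff ω n).2 (Or.inl ⟨n, le_rfl, hSn⟩)
    have hmin : min n (ν ω) = ν ω := min_eq_right hνn
    have hνN' : ν ω < N := hνn.trans_lt hnN
    have hSν : S (ν ω) ω := (hνspec ω).resolve_right (not_le.2 hνN')
    set Tν : ℝ≥0 := CapacityClock.clock D (E (δs k)) (φs k) L (ν ω) ω with hTν
    have hρTν : ρ₀ ≤ Tν := WithTop.coe_le_coe.1 ((hSiff _).1 hSν)
    have hTνle : Tν ≤ ρ₀ + Δ := by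
      rcases Nat.eq_zero_or_pos (ν ω) with h0 | hpos
      · rw [hTν, h0]
        exact hθ0.trans le_add_self
      · have hprev : ¬ S (ν ω - 1) ω := hνmin ω _ (Nat.sub_lt hpos one_pos)
        rw [hSiff, not_le] at hprev
        have hlt : CapacityClock.clock D (E (δs k)) (φs k) L (ν ω - 1) ω < ρ₀ :=
          WithTop.coe_lt_coe.1 hprev
        have hi := hincr (ν ω - 1) ((Nat.sub_le _ _).trans_lt hνN')
        rw [Nat.sub_add_cancel hpos] at hi
        calc Tν ≤ CapacityClock.clock D (E (δs k)) (φs k) L (ν ω - 1) ω + Δ := hi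
          _ ≤ ρ₀ + Δ := add_le_add hlt.le le_rfl
    have h2 : ((ρ₀ : ℝ≥0) : ℝ) ≤ T := by exact_mod_cast hρ₀T
    have h3 : ((T : ℝ≥0) : ℝ) ≤ t' := by exact_mod_cast hTt'
    have hTνL : Tν < L := by
      have h1 : ((Tν : ℝ≥0) : ℝ) ≤ ρ₀ + Δ := by exact_mod_cast hTνle
      have : ((Tν : ℝ≥0) : ℝ) < (L : ℝ) := by rw [hL]; push_cast; linarith
      exact_mod_cast this
    have hTνt' : Tν ≤ t' + 1 := hTνL.le
    have hcapν := CapacityClock.hasCap_clock_of_lt hork' hE₀ (hφs k) L hdesc hTνL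
    -- the driver oscillates by `≤ κ = 1/(j'+1)` on the window `[ρ₀, ρ₀ + Δ]`
    have hρΔ : ((ρ₀ : ℝ≥0) : ℝ) + Δ ≤ j' + 1 := by linarith
    have hosc : ∀ t : ℝ≥0, ρ₀ ≤ t → t ≤ ρ₀ + Δ → |V ω t - V ω ρ₀| ≤ κ := by
      intro t hρt htΔ
      rw [hVapp, hVapp, hκ]
      exact SlitCardyCut.abs_sub_le_of_modulusSet hW₀ hρΔ hΔW hρt htΔ
    obtain ⟨hlt', hcmp⟩ := SlitCardyCut.abs_sub_apply_etaProc_lt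
      (W := fun (w : C(ℝ≥0, ℝ)) (r : ℝ≥0) ↦ w r) (ω := V ω) hĝf hbox' hΨ hVc hV0 hx hρ₀
      hμ₀m hμ₀d hμ₀1 hμ₀μ hκμ hosc hρTν hTνle
    obtain ⟨hA, hEst⟩ := hCk' ω hωC (ν ω) Tν hdesc hcapν hTνt' hlt'
    rw [hXid n ω (by rw [hmin]; exact hA), hmin]
    have hobs : crossingObs f (fun (w : C(ℝ≥0, ℝ)) (r : ℝ≥0) ↦ w r) x m M d T (V ω) =
        f (etaProc (fun (w : C(ℝ≥0, ℝ)) (r : ℝ≥0) ↦ w r) x ρ₀ (V ω)) := by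
      show f (etaProc _ x ((min (T : WithTop ℝ≥0) (levelTime _ x m M d (V ω))).untopA) (V ω)) = _
      rw [hρ₀, min_eq_right hge]
      rfl
    rw [hobs]
    calc |P.real (EventIdentity.slitCrossing (hδadm k) X₁ X₂ ω (ν ω)) -
          f (etaProc (fun (w : C(ℝ≥0, ℝ)) (r : ℝ≥0) ↦ w r) x ρ₀ (V ω))|
        ≤ |P.real (EventIdentity.slitCrossing (hδadm k) X₁ X₂ ω (ν ω)) -
            f (etaProc (fun (w : C(ℝ≥0, ℝ)) (r : ℝ≥0) ↦ w r) x Tν (V ω))| +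
          |f (etaProc (fun (w : C(ℝ≥0, ℝ)) (r : ℝ≥0) ↦ w r) x Tν (V ω)) -
            f (etaProc (fun (w : C(ℝ≥0, ℝ)) (r : ℝ≥0) ↦ w r) x ρ₀ (V ω))| := abs_sub_le _ _ _
      _ ≤ εC k + r / 4 := add_le_add hEst hcmp.le
      _ ≤ r := by linarith

/-- **THE CUT (anchor; cut-1 of STUB A3b `stub_slitObservableApprox` of stmt-CriticalPhenomena-0746)**:
continuity of the kernel on `(0,1)` and the slit-Cardy estimate before the level time with no
early contact imply the slit-observable estimate (`SlitCardyCut.percSlitObservableApprox_of_slitCardy`).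
[cite: CamiaNewman2007, §5 and Thm 3] -/
theorem slitCardy_percSlitObservableApprox_of : ∀ {f : ℝ → ℝ}, ContinuousOn f (Set.Ioo 0 1) → Summit.CriticalPhenomena.CardyFormulaZ2.Cruxes.CardyRigidity.CrossingMartingale.PercSlitCardy f → Summit.CriticalPhenomena.CardyFormulaZ2.Cruxes.CardyRigidity.CrossingMartingale.PercSlitObservableApprox f :=
  fun hf hC ↦ SlitCardyCut.percSlitObservableApprox_of_slitCardy hf hC

end Summit.CriticalPhenomena.CardyFormulaZ2.Cruxes.CardyRigidity.CrossingMartingale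

end
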